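import Mathlib
import Summits.NavierStokesRegularity.NavierStokesRegularity.Theses.LandauTail
import Summits.NavierStokesRegularity.NavierStokesRegularity.Theorems.LandauTailLandauTailBlowupLeray
import Literature.Analysis.FluidPDE.LandauSolutions

/-!
# NavierStokesRegularity — route `LandauTail`, crux `LandauTailBlowup`: the one-parameter Landau
  normal form of the singularity model in Leray's backward similarity variables

Helper file for the crux item `stmt-NavierStokesRegularity-1944` (`LandauTail.LandauTailBlowup`, line
`registered`). The hardest stub of the line, `LandauTailLocal` (item stmt-NavierStokesRegularity-1946),
is in Landau normal form a ONE-PARAMETER problem: for some `A > 1` there is a unit-viscosity classical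
Navier–Stokes solution on `(−1, 0) × ℝ³` with Tsai's local energy bounds on `B₁` whose parabolic tail
`√(−t) u(t, √(−t) y)` converges, for every `y ≠ 0`, to Landau's solution
`Literature.Analysis.FluidPDE.landauSolution 1 A y` (Lemarié-Rieusset 2016, (10.44), axis `e₃`).

`landauTail_oneParam_iff_backwardLeray` is, for EVERY parameter `A`, the dictionary between this
physical formulation and Leray's backward similarity variables
`V(s, y) = e^{−s/2} u(−e^{−s}, e^{−s/2} y)` on `(0, ∞) × ℝ³`
(`Literature.Analysis.FluidPDE.lerayOrbit`, `IsBackwardLeraySolutionOn`): the physical side holds iff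
there is a classical solution `(V, Q)` of the backward Leray system (`ν = 1`) on `(0, ∞) × ℝ³` with the
transported Tsai bounds `∫_{B_{e^{s/2}}} |V(s)|² ≤ C e^{s/2}` (`s > 0`),
`∫₀^∞ e^{−s/2} ∫_{B_{e^{s/2}}} |∇V(s)|²_F ds < ∞`, converging pointwise off the origin, as `s → +∞`,
to the FIXED punctured steady state `landauSolution 1 A`. It is the specialisation of the generic
dictionary `landauTailLocal_iff_backwardLeray` (file `LandauTailLandauTailBlowupLeray`) to the fixed
limit profile; no property of `landauSolution` is used (the profile is just a limit value).

References: J. Leray, Acta Math. 63 (1934), (3.11)–(3.12); D. Chae, J. Wolf, ARMA 225 (2017), §4;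
T.-P. Tsai, ARMA 143 (1998), Thm 2; P. G. Lemarié-Rieusset, The Navier–Stokes problem in the 21st
century (2016), Thm 10.13, (10.44).
-/

noncomputable section

open Filter Set Topology MeasureTheory Metric
open scoped ENNReal NNReal
open Literature.Analysis.FluidPDE

-- the summit-side namespace repeats a component by design (D-0017)
set_option linter.dupNamespace false

namespace Summit.NavierStokesRegularity.NavierStokesRegularity.Theorems

/-- **The one-parameter singularity model in Leray's variables** (kernel-checked equivalence, for
every parameter `A`). A unit-viscosity classical unforced Navier–Stokes solution `(u, p)` on
`(−1, 0) × ℝ³` with Tsai's local energy bounds `sup_t ∫_{B₁} |u(t)|² ≤ C`,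
`∫_{−1}^0 ∫_{B₁} |∇u|²_F < ∞` and the parabolic Landau tail
`√(0 − t) u(t, √(0 − t) y) → landauSolution 1 A y` (`t → 0⁻`, every `y ≠ 0`) exists iff there is a
classical solution `(V, Q)` of the backward Leray system `∂ₛV + ½V + ½(y·∇)V + (V·∇)V + ∇Q = ΔV`,
`div V = 0` on `(0, ∞) × ℝ³` with the transported bounds `∫_{B_{e^{s/2}}} |V(s)|² ≤ C e^{s/2}`
(`s > 0`), `∫₀^∞ e^{−s/2} ∫_{B_{e^{s/2}}} |∇V(s)|²_F ds < ∞`, and `V(s, y) → landauSolution 1 A y` as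
`s → +∞` for every `y ≠ 0`. Directions: `→` reads the witness through `V = lerayOrbit u`,
`Q = lerayOrbitPressure p` (`landauTail_isClassicalNSSolutionOn_Ioo_iff`,
`landauTail_ball_energy_lerayOrbit`, `landauTail_ball_dissipation_lerayOrbit`,
`landauTail_setLIntegral_Ioo_eq_Ioi`, `landauTail_tail_iff_tendsto_lerayOrbit`); `←` through
`u = ofLerayOrbit V`, `p = ofLerayOrbitPressure Q` (`lerayOrbit ∘ ofLerayOrbit = id`). [folklore] -/
theorem landauTail_oneParam_iff_backwardLeray : ∀ A : ℝ, (∃ (u : ℝ → EuclideanSpace ℝ (Fin 3) → EuclideanSpace ℝ (Fin 3)) (p : ℝ → EuclideanSpace ℝ (Fin 3) → ℝ), Literature.Analysis.FluidPDE.IsClassicalNSSolutionOn (Set.Ioo (-1) 0) 1 0 u p ∧ (∃ C : NNReal, ∀ t ∈ Set.Ioo (-1 : ℝ) 0, ∫⁻ x in Metric.ball (0 : EuclideanSpace ℝ (Fin 3)) 1, ‖u t x‖ₑ ^ 2 ≤ C) ∧ (∫⁻ t in Set.Ioo (-1 : ℝ) 0, ∫⁻ x in Metric.ball (0 : EuclideanSpace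 ℝ (Fin 3)) 1, ENNReal.ofReal (Literature.Analysis.FluidPDE.frobeniusNormSq (fderiv ℝ (u t) x)) < ⊤) ∧ ∀ y : EuclideanSpace ℝ (Fin 3), y ≠ 0 → Filter.Tendsto (fun t : ℝ => Real.sqrt (0 - t) • u t (Real.sqrt (0 - t) • y)) (nhdsWithin 0 (Set.Iio 0)) (nhds (Literature.Analysis.FluidPDE.landauSolution 1 A y))) ↔ (∃ (V : ℝ → EuclideanSpace ℝ (Fin 3) → EuclideanSpace ℝ (Fin 3)) (Q : ℝ → EuclideanSpace ℝ (Fin 3) → ℝ), Literature.Analysis.FluidPDE.IsBackwardLeraySolutionOn (Set.Ioi (0 : ℝ)) 1 V Q ∧ (∃ C : NNReal, ∀ s ∈ Set.Ioi (0 : ℝ), ∫⁻ y in Metric.ball (0 : EuclideanSpace ℝ (Fin 3)) (Real.exp (s / 2)), ‖V s y‖ₑ ^ 2 ≤ C * ENNReal.ofReal (Real.exp (s / 2))) ∧ (∫⁻ s in Set.Ioi (0 : ℝ), ENNReal.ofReal (Real.exp (-s / 2)) * ∫⁻ y in Metric.ball (0 : EuclideanSpace ℝ (Fin 3)) (Real.exp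 (s / 2)), ENNReal.ofReal (Literature.Analysis.FluidPDE.frobeniusNormSq (fderiv ℝ (V s) y)) < ⊤) ∧ (∀ y : EuclideanSpace ℝ (Fin 3), y ≠ 0 → Filter.Tendsto (fun s : ℝ => V s y) Filter.atTop (nhds (Literature.Analysis.FluidPDE.landauSolution 1 A y)))) := by
  intro A
  -- pointwise identity of the weighted dissipation integrands (used in both directions)
  have hdiss : ∀ (u : ℝ → EuclideanSpace ℝ (Fin 3) → EuclideanSpace ℝ (Fin 3)) (s : ℝ),
      ENNReal.ofReal (Real.exp (-s / 2)) *
          ∫⁻ y in ball (0 : EuclideanSpace ℝ (Fin 3)) (Real.exp (s / 2)), ENNReal.ofReal (frobeniusNormSq (fderiv ℝ (lerayOrbit u s) y)) =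
        ENNReal.ofReal (Real.exp (-s)) *
          ∫⁻ x in ball (0 : EuclideanSpace ℝ (Fin 3)) 1, ENNReal.ofReal (frobeniusNormSq (fderiv ℝ (u (ancientSimTime s)) x)) := by
    intro u s
    rw [landauTail_ball_dissipation_lerayOrbit, ← mul_assoc, ← ENNReal.ofReal_mul (Real.exp_pos _).le,
      exp_neg_half_mul_self, ancientSimTime_apply]
  constructor
  · rintro ⟨u, p, hcl, ⟨C, hC⟩, hD, htail⟩
    refine ⟨lerayOrbit u, lerayOrbitPressure p, landauTail_isClassicalNSSolutionOn_Ioo_iff.1 hcl,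
      ⟨C, fun s hs => ?_⟩, ?_, fun y hy => ?_⟩
    · -- energy on the expanding balls
      rw [landauTail_ball_energy_lerayOrbit, mul_comm]
      have ht : -Real.exp (-s) ∈ Ioo (-1 : ℝ) 0 := landauTail_ancientSimTime_mem_Ioo hs
      exact mul_le_mul_left (hC _ ht) _
    · -- dissipation
      calc ∫⁻ s in Ioi (0 : ℝ), ENNReal.ofReal (Real.exp (-s / 2)) *
            ∫⁻ y in ball (0 : EuclideanSpace ℝ (Fin 3)) (Real.exp (s / 2)), ENNReal.ofReal (frobeniusNormSq (fderiv ℝ (lerayOrbit u s) y))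
          = ∫⁻ s in Ioi (0 : ℝ), ENNReal.ofReal (Real.exp (-s)) *
            ∫⁻ x in ball (0 : EuclideanSpace ℝ (Fin 3)) 1, ENNReal.ofReal (frobeniusNormSq (fderiv ℝ (u (ancientSimTime s)) x)) :=
            lintegral_congr fun s => hdiss u s
        _ = ∫⁻ t in Ioo (-1 : ℝ) 0, ∫⁻ x in ball (0 : EuclideanSpace ℝ (Fin 3)) 1, ENNReal.ofReal (frobeniusNormSq (fderiv ℝ (u t) x)) :=
            (landauTail_setLIntegral_Ioo_eq_Ioi (fun t =>
              ∫⁻ x in ball (0 : EuclideanSpace ℝ (Fin 3)) 1, ENNReal.ofReal (frobeniusNormSq (fderiv ℝ (u t) x)))).symm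
        _ < ⊤ := hD
    · -- the tail clause is pointwise convergence of the orbit
      exact (landauTail_tail_iff_tendsto_lerayOrbit u y (landauSolution 1 A y)).1 (htail y hy)
  · rintro ⟨V, Q, hL, ⟨C, hC⟩, hD, htail⟩
    set u : ℝ → EuclideanSpace ℝ (Fin 3) → EuclideanSpace ℝ (Fin 3) := ofLerayOrbit V with hu
    set p : ℝ → EuclideanSpace ℝ (Fin 3) → ℝ := ofLerayOrbitPressure Q with hp
    have hV : lerayOrbit u = V := lerayOrbit_ofLerayOrbit_eq V
    have hQ : lerayOrbitPressure p = Q := lerayOrbitPressure_ofLerayOrbitPressure_eq Q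
    refine ⟨u, p, ?_, ⟨C, fun t ht => ?_⟩, ?_, fun y hy => ?_⟩
    · -- dynamics
      rw [landauTail_isClassicalNSSolutionOn_Ioo_iff, hV, hQ]
      exact hL
    · -- energy at a physical time t ∈ (−1, 0), read at s = σ(t)
      set s : ℝ := ancientSimTimeInv t with hs_def
      have hs : 0 < s := landauTail_ancientSimTimeInv_pos ht
      have hts : -Real.exp (-s) = t := ancientSimTime_ancientSimTimeInv ht.2
      have key := landauTail_ball_energy_lerayOrbit u s
      rw [hV, hts] at key
      have hbound : ENNReal.ofReal (Real.exp (s / 2)) * ∫⁻ x in ball (0 : EuclideanSpace ℝ (Fin 3)) 1, ‖u t x‖ₑ ^ 2 ≤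
          ENNReal.ofReal (Real.exp (s / 2)) * C := by
        rw [← key, mul_comm _ (C : ℝ≥0∞)]
        exact hC s hs
      exact (ENNReal.mul_le_mul_iff_right (ENNReal.ofReal_pos.2 (Real.exp_pos _)).ne' ENNReal.ofReal_ne_top).1 hbound
    · -- dissipation
      calc ∫⁻ t in Ioo (-1 : ℝ) 0, ∫⁻ x in ball (0 : EuclideanSpace ℝ (Fin 3)) 1, ENNReal.ofReal (frobeniusNormSq (fderiv ℝ (u t) x))
          = ∫⁻ s in Ioi (0 : ℝ), ENNReal.ofReal (Real.exp (-s)) *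
            ∫⁻ x in ball (0 : EuclideanSpace ℝ (Fin 3)) 1, ENNReal.ofReal (frobeniusNormSq (fderiv ℝ (u (ancientSimTime s)) x)) :=
            landauTail_setLIntegral_Ioo_eq_Ioi (fun t =>
              ∫⁻ x in ball (0 : EuclideanSpace ℝ (Fin 3)) 1, ENNReal.ofReal (frobeniusNormSq (fderiv ℝ (u t) x)))
        _ = ∫⁻ s in Ioi (0 : ℝ), ENNReal.ofReal (Real.exp (-s / 2)) *
            ∫⁻ y in ball (0 : EuclideanSpace ℝ (Fin 3)) (Real.exp (s / 2)), ENNReal.ofReal (frobeniusNormSq (fderiv ℝ (V s) y)) := by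
            refine lintegral_congr fun s => ?_
            rw [← hdiss u s, hV]
        _ < ⊤ := hD
    · -- the tail clause is pointwise convergence of the orbit
      refine (landauTail_tail_iff_tendsto_lerayOrbit u y (landauSolution 1 A y)).2 ?_
      rw [hV]
      exact htail y hy

end Summit.NavierStokesRegularity.NavierStokesRegularity.Theorems

end
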